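import Literature.Algebra.Polynomial.CircuitNumberTightness

/-!
# The norm minimiser of a circuit: existence, and Iliman–de Wolff's Theorem 3.8 in full

[cite: IlimanDewolff2016, §3.2 «Standard Forms and Norm Minimizers of Polynomials Supported on
Circuits» (definition of `s*_f`: «`e^{⟨s*_f, α(j)⟩} = λ_j / b_j` for all `1 ≤ j ≤ n`»; «`s*_f`
indeed is well defined, since application of `log|·|` on both sides yields a linear system of
equations with variables `s*_{k,f}` and the rank of this system has to be `n`, since `conv(A)` is
a simplex»); Proposition 13 («For `f ∈ P_Δ^y` and `c = −Θ_f` the point `s*` is a root and the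
unique global minimizer of `f(e^w)`»); Theorem 17 = Theorem 3.8 of the journal version («Let
`f = λ_0 + ∑ b_j x^{α(j)} + c·x^y ∈ P_Δ^y` … with `α(j) ∈ (2ℕ)ⁿ`. Then the following are
equivalent. (1) `f` is nonnegative. (2) `|c| ≤ Θ_f` and `y ∉ (2ℕ)ⁿ` or `c ≥ −Θ_f` and
`y ∈ (2ℕ)ⁿ`.») and its proof («for every `1 ≤ j ≤ k` replacing `x_j` by `−x_j` changes the sign
of the term `c·x^y`»; «with the componentwise bijection between `ℝ_{>0}ⁿ` and `ℝⁿ` given by the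
Exp-map, it follows that `f(x) ≥ 0` for all `x ∈ ℝⁿ` if and only if `f(e^w) ≥ 0` for all
`w ∈ ℝⁿ`»; «Hence, `f_c(e^w) < 0` for some `w ∈ ℝⁿ` if and only if `c < −Θ_f`»)]
[cite: MagronSeidlerDewolff2019, Definition 2 (circuit polynomial: `b_{α(j)} ∈ ℝ_{>0}`,
`α(j) ∈ (2ℤ)ⁿ`, «there exist unique, positive barycentric coordinates `λ_j` relative to the
`α(j)`» with `β = ∑ λ_j α(j)`), Theorem 2.1 («Let `p` be a circuit polynomial … Then `p` is
nonnegative if and only if: `p` is a sum of monomial squares, or the coefficient `b_β` of the inner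
term of `p` satisfies `|b_β| ≤ Θ_p`.»)]

`Literature.Algebra.Polynomial.CircuitNumberNonnegativity` proves the certificate directions of
Iliman–de Wolff's theorem (`−Θ ≤ c`, resp. `|c| ≤ Θ`, implies nonnegativity) and
`Literature.Algebra.Polynomial.CircuitNumberTightness` proves the converse *given* an equalising
point `x*` (`b_j e^{α(j)·x*} = λ_j Θ e^{β·x*}` for every outer index `j` — the norm minimiser
`e^{s*}` of the source without its normalisation `α(0) = 0`, `b_0 = λ_0`), constructing `x*` in
closed form only for two outer points in dimension one.  This file supplies the missing existence
statement in general and assembles the full characterisation: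

* `exists_dotProduct_eq_of_linearIndependent`: a linear system `v_k · x = r_k` with linearly
  independent rows is solvable (the «rank `n`» remark of the source, over any field);
* `sum_mul_log_share_eq_zero`: the log-shares `L_j = log(λ_j Θ / b_j)` satisfy `∑ λ_j L_j = 0` —
  this is *exactly* the statement that `Θ` is the circuit number, and it is the consistency
  condition of the (affinely dependent) system `(α(j) − β)·x = L_j`;
* `exists_equalising_point`: for positive coefficients, positive barycentric coordinates and
  **affinely independent** outer exponents `α(j) ∈ ℝⁿ` (any number of them — a simplex of any
  dimension inside `ℝⁿ`, as in [MagronSeidlerDewolff2019, Definition 2]) an equalising point exists;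
* `signomial_nonneg_iff`: hence `∑ b_j e^{α(j)·x} + c e^{β·x} ≥ 0` on `ℝⁿ` **iff** `−Θ ≤ c`, with a
  root at the equalising point when `c = −Θ` (Proposition 13) and a negative value there when
  `c < −Θ`;
* the polynomial form, [IlimanDewolff2016, Theorem 3.8] = [MagronSeidlerDewolff2019, Theorem 2.1]
  in full: for a circuit polynomial `p = ∑ b_j x^{α(j)} + c x^β` (`b_j > 0`, `α(j) ∈ (2ℕ)ⁿ` affinely
  independent, `β = ∑ λ_j α(j)`, `λ_j > 0`), `p ≥ 0` on `ℝⁿ` iff `|c| ≤ Θ_p`, or `β ∈ (2ℕ)ⁿ` and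
  `c ≥ −Θ_p` (`circuitPolynomial_nonneg_iff`; equivalently: `p` is a sum of monomial squares or
  `|c| ≤ Θ_p`, `circuitPolynomial_nonneg_iff'`), via the two reductions of the source's proof —
  restriction to the open orthant `x = e^y` (`signomial_nonneg_of_circuitPolynomial_nonneg`) and the
  sign symmetry `x_k ↦ −x_k` in an odd inner coordinate (`circuitPolynomial_reflect`) — and the
  `MvPolynomial` packaging `eval_circuitPolynomial_nonneg_iff`.

All statements are fully proved; no named facts.  Not formalised: uniqueness of the minimiser
(it holds only when the simplex is full-dimensional) and the count of real zeros of boundary forms.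
Numbering: as in the companion files, «Theorem 3.8» is the journal number (Res. Math. Sci. 3
(2016)) quoted by [MagronSeidlerDewolff2019, Theorem 2.1]; «§3.2», «Proposition 13»,
«Theorem 17» are the numbers of the arXiv text (1402.0462) held in the literature store.
-/

namespace Literature.Algebra.Polynomial.CircuitNormMinimiser

open Finset Matrix Literature.Algebra.Polynomial.CircuitNumberNonnegativity
  Literature.Algebra.Polynomial.CircuitNumberTightness

/-! ## Linear algebra: the log-linear system for the norm minimiser is solvable -/

section LinearAlgebra

/-- A linear system `v_k · x = r_k` (`k ∈ κ`) whose coefficient rows `v_k` are linearly independent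
has a solution: the matrix with these rows has rank `#κ`, so `x ↦ (v_k · x)_k` is onto.  This is
the «rank of this system» remark that makes the norm minimiser well defined.
[cite: IlimanDewolff2016, §3.2 (well-definedness of the norm minimiser s*_f: «the rank of this
system has to be n, since conv(A) is a simplex»)] -/
theorem exists_dotProduct_eq_of_linearIndependent {K : Type*} [Field K] {κ m : Type*}
    [Fintype κ] [Fintype m] {v : κ → m → K} (hv : LinearIndependent K v) (r : κ → K) :
    ∃ x : m → K, ∀ k, v k ⬝ᵥ x = r k := by
  classical
  have hrank : (Matrix.of v).rank = Fintype.card κ :=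
    LinearIndependent.rank_matrix (M := Matrix.of v) hv
  have htop : LinearMap.range (Matrix.of v).mulVecLin = ⊤ := by
    apply Submodule.eq_top_of_finrank_eq
    rw [Module.finrank_fintype_fun_eq_card]
    exact hrank
  have hr : r ∈ LinearMap.range (Matrix.of v).mulVecLin := by
    rw [htop]; exact Submodule.mem_top
  obtain ⟨x, hx⟩ := hr
  exact ⟨x, fun k => by rw [← hx]; rfl⟩

variable {ι : Type*} [Fintype ι] {n : Type*} [Fintype n]

/-- The affine version used for circuits: if the points `α(j) ∈ ℝⁿ` are affinely independent,
`β = ∑ λ_j α(j)` with `∑ λ_j = 1`, and the right-hand sides satisfy the one forced relation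
`∑ λ_j L_j = 0`, then the system `(α(j) − β)·x = L_j` (all `j`) has a solution.  (Reduce to the
linearly independent differences `α(j) − α(j₀)`.)
[cite: IlimanDewolff2016, §3.2 (the linear system for s*_f obtained by «application of log|·| on
both sides»)] -/
theorem exists_dotProduct_sub_eq_of_affineIndependent {α : ι → n → ℝ}
    (hα : AffineIndependent ℝ α) {w : ι → ℝ} (hw1 : ∑ j, w j = 1) {β : n → ℝ}
    (hβ : ∀ i, β i = ∑ j, w j * α j i) {L : ι → ℝ} (hL : ∑ j, w j * L j = 0) :
    ∃ x : n → ℝ, ∀ j, α j ⬝ᵥ x - β ⬝ᵥ x = L j := by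
  classical
  haveI : Nonempty ι := by
    by_contra h
    rw [not_nonempty_iff] at h
    simp at hw1
  obtain ⟨j₀⟩ := (inferInstance : Nonempty ι)
  have hli := (affineIndependent_iff_linearIndependent_vsub ℝ α j₀).mp hα
  simp only [vsub_eq_sub] at hli
  obtain ⟨x, hx⟩ := exists_dotProduct_eq_of_linearIndependent hli fun i => L i - L j₀
  have hall : ∀ j, α j ⬝ᵥ x = α j₀ ⬝ᵥ x + (L j - L j₀) := by
    intro j
    by_cases hj : j = j₀
    · subst hj; ring
    · have h := hx ⟨j, hj⟩
      rw [sub_dotProduct] at h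
      linarith
  have hβx : β ⬝ᵥ x = α j₀ ⬝ᵥ x - L j₀ := by
    rw [dotProduct_eq_sum_of_barycentre hβ x]
    have h : ∑ j, w j * (α j ⬝ᵥ x)
        = (α j₀ ⬝ᵥ x - L j₀) * ∑ j, w j + ∑ j, w j * L j := by
      rw [mul_sum, ← sum_add_distrib]
      exact sum_congr rfl fun j _ => by rw [hall j]; ring
    rw [h, hw1, hL]; ring
  exact ⟨x, fun j => by rw [hall j, hβx]; ring⟩

end LinearAlgebra

/-! ## Existence of the equalising point (norm minimiser) of a circuit -/

section EqualisingPoint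

variable {ι : Type*} [Fintype ι] {n : Type*} [Fintype n]

/-- **Consistency of the log-linear system** — the identity that *defines* the circuit number: for
positive `b`, positive weights `λ` summing to one and `Θ = ∏ (b_j/λ_j)^{λ_j}`,
`∑_j λ_j log(λ_j Θ / b_j) = 0`.  (The two-point case is
`CircuitNumberTightness.weighted_log_share_sum_eq_zero`.)
[cite: IlimanDewolff2016, §3.2 (Θ_f = ∏ (b_j/λ_j)^{λ_j} and the linear system for s*_f)] -/
theorem sum_mul_log_share_eq_zero {b w : ι → ℝ} (hb : ∀ j, 0 < b j) (hw : ∀ j, 0 < w j)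
    (hw1 : ∑ j, w j = 1) :
    ∑ j, w j * Real.log (w j * circuitNumber b w / b j) = 0 := by
  have hΘ : 0 < circuitNumber b w := circuitNumber_pos hb hw
  have hlogΘ : Real.log (circuitNumber b w)
      = ∑ j, w j * (Real.log (b j) - Real.log (w j)) := by
    unfold circuitNumber
    rw [Real.log_prod fun j _ => (Real.rpow_pos_of_pos (div_pos (hb j) (hw j)) _).ne']
    exact sum_congr rfl fun j _ => by
      rw [Real.log_rpow (div_pos (hb j) (hw j)), Real.log_div (hb j).ne' (hw j).ne']
  have hj : ∀ j, Real.log (w j * circuitNumber b w / b j)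
      = Real.log (w j) + Real.log (circuitNumber b w) - Real.log (b j) := fun j => by
    rw [Real.log_div (mul_pos (hw j) hΘ).ne' (hb j).ne', Real.log_mul (hw j).ne' hΘ.ne']
  simp_rw [hj]
  have h : ∑ j, w j * (Real.log (w j) + Real.log (circuitNumber b w) - Real.log (b j))
      = Real.log (circuitNumber b w) * ∑ j, w j
        - ∑ j, w j * (Real.log (b j) - Real.log (w j)) := by
    rw [mul_sum, ← sum_sub_distrib]
    exact sum_congr rfl fun j _ => by ring
  rw [h, hw1, ← hlogΘ]; ring

/-- The **log-linear form of the equalising point**: there is `x ∈ ℝⁿ` with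
`(α(j) − β)·x = log(λ_j Θ / b_j)` for every outer index `j` (positive data, affinely independent
`α(j)`, `β` their `λ`-barycentre) — the system «obtained by application of `log|·|`» whose
solvability is the well-definedness of the norm minimiser `s*`.
[cite: IlimanDewolff2016, §3.2 (definition and well-definedness of s*_f)] -/
theorem exists_log_equalising_point {b w : ι → ℝ} (hb : ∀ j, 0 < b j) (hw : ∀ j, 0 < w j)
    (hw1 : ∑ j, w j = 1) {α : ι → n → ℝ} (hα : AffineIndependent ℝ α) {β : n → ℝ}
    (hβ : ∀ i, β i = ∑ j, w j * α j i) :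
    ∃ x : n → ℝ, ∀ j, α j ⬝ᵥ x - β ⬝ᵥ x = Real.log (w j * circuitNumber b w / b j) :=
  exists_dotProduct_sub_eq_of_affineIndependent hα hw1 hβ (sum_mul_log_share_eq_zero hb hw hw1)

/-- **Existence of the equalising point / norm minimiser** for a general circuit: if the outer
exponents `α(j) ∈ ℝⁿ` are affinely independent, `β = ∑ λ_j α(j)` with `λ_j > 0`, `∑ λ_j = 1`, and
`b_j > 0`, then some `x* ∈ ℝⁿ` satisfies all share equations `b_j e^{α(j)·x*} = λ_j Θ e^{β·x*}`.
With the source's normalisation `α(0) = 0`, `b_0 = λ_0` this is `e^{⟨s*, α(j)⟩} = λ_j / b_j`, i.e.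
`x* = s*_f`.  (For fewer than `n + 1` outer points the point is not unique.)
[cite: IlimanDewolff2016, §3.2 (norm minimiser s*_f) and Proposition 13] -/
theorem exists_equalising_point {b w : ι → ℝ} (hb : ∀ j, 0 < b j) (hw : ∀ j, 0 < w j)
    (hw1 : ∑ j, w j = 1) {α : ι → n → ℝ} (hα : AffineIndependent ℝ α) {β : n → ℝ}
    (hβ : ∀ i, β i = ∑ j, w j * α j i) :
    ∃ x : n → ℝ, ∀ j, b j * Real.exp (α j ⬝ᵥ x)
      = w j * circuitNumber b w * Real.exp (β ⬝ᵥ x) := by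
  obtain ⟨x, hx⟩ := exists_log_equalising_point hb hw hw1 hα hβ
  refine ⟨x, fun j => ?_⟩
  have hΘ : 0 < circuitNumber b w := circuitNumber_pos hb hw
  have hbj : b j ≠ 0 := (hb j).ne'
  have h1 : α j ⬝ᵥ x = β ⬝ᵥ x + Real.log (w j * circuitNumber b w / b j) := by
    linarith [hx j]
  rw [h1, Real.exp_add, Real.exp_log (div_pos (mul_pos (hw j) hΘ) (hb j))]
  field_simp

end EqualisingPoint

/-! ## The signomial (exponential) form of Theorem 3.8, unconditionally -/

section Signomial

variable {ι : Type*} [Fintype ι] {n : Type*} [Fintype n]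

/-- **Iliman–de Wolff Theorem 3.8 on the open orthant, in full**: for positive coefficients,
positive barycentric coordinates and affinely independent outer exponents,
`∑_j b_j e^{α(j)·x} + c e^{β·x} ≥ 0` for all `x ∈ ℝⁿ` **iff** `−Θ ≤ c` («`f(e^w) ≥ 0` for all
`w ∈ ℝⁿ` if and only if `c ∈ [−Θ_f, 0]`», for `c ≤ 0`).
[cite: IlimanDewolff2016, Theorem 3.8 (= arXiv Theorem 17), the statement «f(e^w) ≥ 0 for all
w ∈ ℝⁿ if and only if c ∈ [−Θ_f, 0]» of its proof, via Proposition 13]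
[cite: ChandrasekaranShah2016, §2.1] -/
theorem signomial_nonneg_iff {b w : ι → ℝ} (hb : ∀ j, 0 < b j) (hw : ∀ j, 0 < w j)
    (hw1 : ∑ j, w j = 1) {α : ι → n → ℝ} (hα : AffineIndependent ℝ α) {β : n → ℝ}
    (hβ : ∀ i, β i = ∑ j, w j * α j i) {c : ℝ} :
    (∀ x : n → ℝ, 0 ≤ ∑ j, b j * Real.exp (α j ⬝ᵥ x) + c * Real.exp (β ⬝ᵥ x))
      ↔ -circuitNumber b w ≤ c :=
  signomial_nonneg_iff_of_equalising_point (fun j => (hb j).le) (fun j => (hw j).le) hw1 hβ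
    (exists_equalising_point hb hw hw1 hα hβ)

/-- **Proposition 13, root part**: for `c = −Θ` the signomial vanishes at the equalising point
(and is nonnegative everywhere by the companion file, so the point is a global minimiser with
minimum `0`).
[cite: IlimanDewolff2016, Proposition 13 («the point s* is a root and the unique global minimizer
of f(e^w)» for c = −Θ_f)] -/
theorem exists_signomial_eq_zero {b w : ι → ℝ} (hb : ∀ j, 0 < b j) (hw : ∀ j, 0 < w j)
    (hw1 : ∑ j, w j = 1) {α : ι → n → ℝ} (hα : AffineIndependent ℝ α) {β : n → ℝ}
    (hβ : ∀ i, β i = ∑ j, w j * α j i) :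
    ∃ x : n → ℝ, (∑ j, b j * Real.exp (α j ⬝ᵥ x)
        + -circuitNumber b w * Real.exp (β ⬝ᵥ x) = 0)
      ∧ ∀ y : n → ℝ, 0 ≤ ∑ j, b j * Real.exp (α j ⬝ᵥ y)
        + -circuitNumber b w * Real.exp (β ⬝ᵥ y) := by
  obtain ⟨x, hx⟩ := exists_equalising_point hb hw hw1 hα hβ
  refine ⟨x, ?_, fun y => signomial_nonneg_of_neg_circuitNumber_le (fun j => (hb j).le)
    (fun j => (hw j).le) hw1 hβ le_rfl y⟩
  rw [signomial_eq_at_equalising_point hw1 _ hx]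
  ring

/-- … and for `c < −Θ` the signomial is **negative** at the equalising point («`f_c(e^w) < 0` for
some `w ∈ ℝⁿ` if and only if `c < −Θ_f`»).
[cite: IlimanDewolff2016, Theorem 3.8 (proof, last paragraph: «a term by term inspection yields
that f_c(e^w) < f_{−Θ_f}(e^w) if and only if c < −Θ_f»)] -/
theorem exists_signomial_neg_of_lt {b w : ι → ℝ} (hb : ∀ j, 0 < b j) (hw : ∀ j, 0 < w j)
    (hw1 : ∑ j, w j = 1) {α : ι → n → ℝ} (hα : AffineIndependent ℝ α) {β : n → ℝ}
    (hβ : ∀ i, β i = ∑ j, w j * α j i) {c : ℝ} (hc : c < -circuitNumber b w) :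
    ∃ x : n → ℝ, ∑ j, b j * Real.exp (α j ⬝ᵥ x) + c * Real.exp (β ⬝ᵥ x) < 0 := by
  obtain ⟨x, hx⟩ := exists_equalising_point hb hw hw1 hα hβ
  refine ⟨x, ?_⟩
  rw [signomial_eq_at_equalising_point hw1 c hx]
  exact mul_neg_of_neg_of_pos (by linarith) (Real.exp_pos _)

/-- The exact dichotomy: a negative value exists iff `c < −Θ`.
[cite: IlimanDewolff2016, Theorem 3.8 (proof: «Hence, f_c(e^w) < 0 for some w ∈ ℝⁿ if and only
if c < −Θ_f»)] -/
theorem exists_signomial_neg_iff {b w : ι → ℝ} (hb : ∀ j, 0 < b j) (hw : ∀ j, 0 < w j)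
    (hw1 : ∑ j, w j = 1) {α : ι → n → ℝ} (hα : AffineIndependent ℝ α) {β : n → ℝ}
    (hβ : ∀ i, β i = ∑ j, w j * α j i) {c : ℝ} :
    (∃ x : n → ℝ, ∑ j, b j * Real.exp (α j ⬝ᵥ x) + c * Real.exp (β ⬝ᵥ x) < 0)
      ↔ c < -circuitNumber b w := by
  constructor
  · rintro ⟨x, hx⟩
    by_contra h
    have h0 := (signomial_nonneg_iff hb hw hw1 hα hβ).mpr (not_lt.mp h) x
    linarith
  · exact exists_signomial_neg_of_lt hb hw hw1 hα hβ

end Signomial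

/-! ## The polynomial form: Theorem 3.8 / Theorem 2.1 in full -/

section Polynomial

variable {ι : Type*} [Fintype ι] {n : Type*} [Fintype n]

/-- On the open positive orthant `x = e^y` (componentwise) a monomial is an exponential:
`∏_i (e^{y_i})^{a_i} = e^{a·y}`.
[cite: IlimanDewolff2016, Theorem 3.8 (proof: «the componentwise bijection between ℝ_{>0}ⁿ and ℝⁿ
given by the Exp-map»)] -/
theorem prod_exp_pow_eq_exp_dotProduct (a : n → ℕ) (y : n → ℝ) :
    ∏ i, Real.exp (y i) ^ a i = Real.exp ((fun i => (a i : ℝ)) ⬝ᵥ y) := by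
  rw [dotProduct, Real.exp_sum]
  exact prod_congr rfl fun i _ => by rw [← Real.exp_nat_mul]

/-- **Restriction to the positive orthant**: if the polynomial `p = ∑ b_j x^{a(j)} + c x^β` is
nonnegative on `ℝⁿ` then the signomial `∑ b_j e^{a(j)·y} + c e^{β·y}` is nonnegative on `ℝⁿ`
(evaluate `p` at `x = e^y`).
[cite: IlimanDewolff2016, Theorem 3.8 (proof: «f(x) ≥ 0 for all x ∈ ℝⁿ if and only if
f(e^w) ≥ 0 for all w ∈ ℝⁿ», the `only if` half)] -/
theorem signomial_nonneg_of_circuitPolynomial_nonneg {b : ι → ℝ} {a : ι → n → ℕ} {β : n → ℕ}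
    {c : ℝ} (hp : ∀ x : n → ℝ, 0 ≤ ∑ j, b j * ∏ i, x i ^ a j i + c * ∏ i, x i ^ β i)
    (y : n → ℝ) :
    0 ≤ ∑ j, b j * Real.exp ((fun i => (a j i : ℝ)) ⬝ᵥ y)
      + c * Real.exp ((fun i => (β i : ℝ)) ⬝ᵥ y) := by
  have h := hp fun i => Real.exp (y i)
  simpa only [prod_exp_pow_eq_exp_dotProduct] using h

/-- Reflecting one coordinate, `x_k ↦ −x_k`, multiplies a monomial `x^e` by `(−1)^{e_k}`.
[cite: IlimanDewolff2016, Theorem 3.8 (proof: «replacing x_j by −x_j changes the sign of the term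
c·x^y»)] -/
theorem prod_pow_reflect [DecidableEq n] (x : n → ℝ) (k : n) (e : n → ℕ) :
    ∏ i, (if i = k then -x i else x i) ^ e i = (-1) ^ e k * ∏ i, x i ^ e i := by
  have h : ∀ i, (if i = k then -x i else x i) ^ e i
      = (if i = k then ((-1 : ℝ) ^ e i) else 1) * x i ^ e i := by
    intro i
    split_ifs
    · rw [neg_pow]
    · rw [one_mul]
  simp_rw [h, prod_mul_distrib]
  rw [prod_ite_eq' univ k fun i => ((-1 : ℝ) ^ e i)]
  simp

/-- **The sign symmetry of a circuit polynomial**: with even outer exponents and an inner exponent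
odd in coordinate `k`, reflecting `x_k` turns `p = ∑ b_j x^{a(j)} + c x^β` into
`∑ b_j x^{a(j)} − c x^β` — so the nonnegativity of `p` is that of the circuit polynomial with inner
coefficient `−c`.
[cite: IlimanDewolff2016, Theorem 3.8 (proof: «for every 1 ≤ j ≤ k replacing x_j by −x_j changes
the sign of the term c·x^y. Since all other terms of f are nonnegative …»)] -/
theorem circuitPolynomial_reflect [DecidableEq n] {b : ι → ℝ} {a : ι → n → ℕ}
    (ha : ∀ j i, Even (a j i)) {β : n → ℕ} {k : n} (hk : Odd (β k)) (c : ℝ) (x : n → ℝ) :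
    (∑ j, b j * ∏ i, (if i = k then -x i else x i) ^ a j i
        + c * ∏ i, (if i = k then -x i else x i) ^ β i)
      = ∑ j, b j * ∏ i, x i ^ a j i + -c * ∏ i, x i ^ β i := by
  simp only [prod_pow_reflect x k, Even.neg_one_pow (ha _ k), hk.neg_one_pow, one_mul]
  ring

/-- **Necessity of `c ≥ −Θ`** (no parity hypothesis on the exponents is needed for this half): a
circuit polynomial with `b_j > 0`, affinely independent outer exponents and `β = ∑ λ_j a(j)`,
`λ_j > 0`, that is nonnegative on `ℝⁿ` has `−Θ_p ≤ c`.
[cite: IlimanDewolff2016, Theorem 3.8, (1) ⇒ (2) (restriction to x = e^w and Proposition 13)]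
[cite: MagronSeidlerDewolff2019, Theorem 2.1 (`only if`)] -/
theorem neg_circuitNumber_le_of_circuitPolynomial_nonneg {b w : ι → ℝ} (hb : ∀ j, 0 < b j)
    (hw : ∀ j, 0 < w j) (hw1 : ∑ j, w j = 1) {a : ι → n → ℕ}
    (hα : AffineIndependent ℝ fun j i => (a j i : ℝ)) {β : n → ℕ}
    (hβ : ∀ i, (β i : ℝ) = ∑ j, w j * a j i) {c : ℝ}
    (hp : ∀ x : n → ℝ, 0 ≤ ∑ j, b j * ∏ i, x i ^ a j i + c * ∏ i, x i ^ β i) :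
    -circuitNumber b w ≤ c :=
  (signomial_nonneg_iff hb hw hw1 hα (β := fun i => (β i : ℝ)) hβ).mp
    (signomial_nonneg_of_circuitPolynomial_nonneg hp)

/-- **Necessity of `c ≤ Θ` when the inner exponent has an odd coordinate** (outer exponents even):
reflect that coordinate and apply the previous statement to `−c`.
[cite: IlimanDewolff2016, Theorem 3.8, (1) ⇒ (2), case y ∉ (2ℕ)ⁿ]
[cite: MagronSeidlerDewolff2019, Theorem 2.1 (`only if`)] -/
theorem le_circuitNumber_of_circuitPolynomial_nonneg {b w : ι → ℝ} (hb : ∀ j, 0 < b j)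
    (hw : ∀ j, 0 < w j) (hw1 : ∑ j, w j = 1) {a : ι → n → ℕ} (ha : ∀ j i, Even (a j i))
    (hα : AffineIndependent ℝ fun j i => (a j i : ℝ)) {β : n → ℕ}
    (hβ : ∀ i, (β i : ℝ) = ∑ j, w j * a j i) {k : n} (hk : Odd (β k)) {c : ℝ}
    (hp : ∀ x : n → ℝ, 0 ≤ ∑ j, b j * ∏ i, x i ^ a j i + c * ∏ i, x i ^ β i) :
    c ≤ circuitNumber b w := by
  classical
  have hq : ∀ x : n → ℝ, 0 ≤ ∑ j, b j * ∏ i, x i ^ a j i + -c * ∏ i, x i ^ β i := fun x => by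
    rw [← circuitPolynomial_reflect ha hk c x]
    exact hp _
  have h := neg_circuitNumber_le_of_circuitPolynomial_nonneg hb hw hw1 hα hβ hq
  linarith

/-- Both necessities together: `β ∉ (2ℕ)ⁿ` and `p ≥ 0` force `|c| ≤ Θ_p`.
[cite: IlimanDewolff2016, Theorem 3.8, (1) ⇒ (2), case y ∉ (2ℕ)ⁿ]
[cite: MagronSeidlerDewolff2019, Theorem 2.1] -/
theorem abs_le_circuitNumber_of_circuitPolynomial_nonneg {b w : ι → ℝ} (hb : ∀ j, 0 < b j)
    (hw : ∀ j, 0 < w j) (hw1 : ∑ j, w j = 1) {a : ι → n → ℕ} (ha : ∀ j i, Even (a j i))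
    (hα : AffineIndependent ℝ fun j i => (a j i : ℝ)) {β : n → ℕ}
    (hβ : ∀ i, (β i : ℝ) = ∑ j, w j * a j i) (hodd : ∃ k, Odd (β k)) {c : ℝ}
    (hp : ∀ x : n → ℝ, 0 ≤ ∑ j, b j * ∏ i, x i ^ a j i + c * ∏ i, x i ^ β i) :
    |c| ≤ circuitNumber b w := by
  obtain ⟨k, hk⟩ := hodd
  exact abs_le.mpr ⟨neg_circuitNumber_le_of_circuitPolynomial_nonneg hb hw hw1 hα hβ hp,
    le_circuitNumber_of_circuitPolynomial_nonneg hb hw hw1 ha hα hβ hk hp⟩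

/-- **Iliman–de Wolff Theorem 3.8 / Magron–Seidler–de Wolff Theorem 2.1, in full.**  Let
`p = ∑_j b_j x^{a(j)} + c x^β` with `b_j > 0`, even and affinely independent outer exponents
`a(j) ∈ (2ℕ)ⁿ`, and inner exponent `β = ∑ λ_j a(j)`, `λ_j > 0`, `∑ λ_j = 1`.  Then `p ≥ 0` on `ℝⁿ`
iff `|c| ≤ Θ_p`, or `β ∈ (2ℕ)ⁿ` and `c ≥ −Θ_p` (the source's (2): «`|c| ≤ Θ_f` and `y ∉ (2ℕ)ⁿ`
or `c ≥ −Θ_f` and `y ∈ (2ℕ)ⁿ`», rearranged).  The `if` half is the companion file's.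
[cite: IlimanDewolff2016, Theorem 3.8 ((1) ⇔ (2); arXiv Theorem 17)]
[cite: MagronSeidlerDewolff2019, Theorem 2.1] -/
theorem circuitPolynomial_nonneg_iff {b w : ι → ℝ} (hb : ∀ j, 0 < b j) (hw : ∀ j, 0 < w j)
    (hw1 : ∑ j, w j = 1) {a : ι → n → ℕ} (ha : ∀ j i, Even (a j i))
    (hα : AffineIndependent ℝ fun j i => (a j i : ℝ)) {β : n → ℕ}
    (hβ : ∀ i, (β i : ℝ) = ∑ j, w j * a j i) {c : ℝ} :
    (∀ x : n → ℝ, 0 ≤ ∑ j, b j * ∏ i, x i ^ a j i + c * ∏ i, x i ^ β i)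
      ↔ (|c| ≤ circuitNumber b w ∨ ((∀ i, Even (β i)) ∧ -circuitNumber b w ≤ c)) := by
  constructor
  · intro hp
    by_cases he : ∀ i, Even (β i)
    · exact Or.inr ⟨he, neg_circuitNumber_le_of_circuitPolynomial_nonneg hb hw hw1 hα hβ hp⟩
    · push Not at he
      obtain ⟨k, hk⟩ := he
      exact Or.inl (abs_le_circuitNumber_of_circuitPolynomial_nonneg hb hw hw1 ha hα hβ
        ⟨k, Nat.not_even_iff_odd.mp hk⟩ hp)
  · rintro (h | ⟨he, h⟩) x
    · exact circuitPolynomial_nonneg_of_abs_le (fun j => (hb j).le) (fun j => (hw j).le) hw1 ha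
        hβ h x
    · exact circuitPolynomial_nonneg_of_neg_le (fun j => (hb j).le) (fun j => (hw j).le) hw1 ha
        hβ he h x

/-- The same characterisation in the wording of [MagronSeidlerDewolff2019, Theorem 2.1]: `p ≥ 0`
iff `p` is a sum of monomial squares (`c ≥ 0` and `β` even — the outer terms are monomial squares
anyway) or `|c| ≤ Θ_p`.
[cite: MagronSeidlerDewolff2019, Theorem 2.1 («p is nonnegative if and only if: p is a sum of
monomial squares, or … |b_β| ≤ Θ_p»)] [cite: IlimanDewolff2016, Theorem 3.8] -/
theorem circuitPolynomial_nonneg_iff' {b w : ι → ℝ} (hb : ∀ j, 0 < b j) (hw : ∀ j, 0 < w j)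
    (hw1 : ∑ j, w j = 1) {a : ι → n → ℕ} (ha : ∀ j i, Even (a j i))
    (hα : AffineIndependent ℝ fun j i => (a j i : ℝ)) {β : n → ℕ}
    (hβ : ∀ i, (β i : ℝ) = ∑ j, w j * a j i) {c : ℝ} :
    (∀ x : n → ℝ, 0 ≤ ∑ j, b j * ∏ i, x i ^ a j i + c * ∏ i, x i ^ β i)
      ↔ ((0 ≤ c ∧ ∀ i, Even (β i)) ∨ |c| ≤ circuitNumber b w) := by
  rw [circuitPolynomial_nonneg_iff hb hw hw1 ha hα hβ]
  have hΘ : 0 < circuitNumber b w := circuitNumber_pos hb hw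
  constructor
  · rintro (h | ⟨he, h⟩)
    · exact Or.inr h
    · by_cases hc : 0 ≤ c
      · exact Or.inl ⟨hc, he⟩
      · exact Or.inr (abs_le.mpr ⟨h, by linarith⟩)
  · rintro (⟨hc, he⟩ | h)
    · exact Or.inr ⟨he, by linarith⟩
    · exact Or.inl h

/-- The characterisation for the `MvPolynomial` `p = ∑_j b_j X^{a(j)} + c X^β`
(`a(j), β : n →₀ ℕ`), completing `CircuitNumberNonnegativity.eval_circuitPolynomial_nonneg` to an
equivalence.
[cite: IlimanDewolff2016, Theorem 3.8] [cite: MagronSeidlerDewolff2019, Theorem 2.1] -/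
theorem eval_circuitPolynomial_nonneg_iff {b w : ι → ℝ} (hb : ∀ j, 0 < b j) (hw : ∀ j, 0 < w j)
    (hw1 : ∑ j, w j = 1) {a : ι → n →₀ ℕ} (ha : ∀ j i, Even (a j i))
    (hα : AffineIndependent ℝ fun j i => (a j i : ℝ)) {β : n →₀ ℕ}
    (hβ : ∀ i, (β i : ℝ) = ∑ j, w j * a j i) {c : ℝ} :
    (∀ x : n → ℝ, 0 ≤ MvPolynomial.eval x
        (∑ j, MvPolynomial.monomial (a j) (b j) + MvPolynomial.monomial β c))
      ↔ (|c| ≤ circuitNumber b w ∨ ((∀ i, Even (β i)) ∧ -circuitNumber b w ≤ c)) := by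
  have hmon : ∀ (x : n → ℝ) (s : n →₀ ℕ) (r : ℝ),
      MvPolynomial.eval x (MvPolynomial.monomial s r) = r * ∏ i, x i ^ s i := fun x s r => by
    rw [MvPolynomial.eval_monomial, Finsupp.prod_fintype _ _ fun i => pow_zero _]
  simp_rw [map_add, map_sum, hmon]
  exact circuitPolynomial_nonneg_iff hb hw hw1 (a := fun j i => a j i) ha hα hβ

end Polynomial

end Literature.Algebra.Polynomial.CircuitNormMinimiser
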